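import Mathlib
import HarnessLib
import Summits.PneNP.PneNP.Theses.RamseyUncertifiable
import Summits.PneNP.PneNP.Theorems.RamseyUncertifiableRamseyNotNPProofSystemForm
import Summits.PneNP.PneNP.Theorems.RamseyUncertifiableResolutionUncertaintyTreeLikeUncertainty
import Summits.PneNP.PneNP.Theorems.RamseyUncertifiableRamseyAbundant
import Literature.Computability.MetaComplexity.ProofSystems
import Literature.Computability.MetaComplexity.Resolution
import Literature.Computability.Complexity.HamCircuitNP
import Literature.Computability.Complexity.TM2PassThrough

/-!
# Line `ladder-dag-resolution` — LADDER-DOWN skeleton for the crux `RamseyNotNP`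
(stmt-PneNP-9814, route `RamseyUncertifiable`; forward generator G4, unit fwd-ladder-PneNP-50)

X = `RamseyNotNP` : RAMSEY₂ (codes of `⟨n, G⟩` with `ω(G), α(G) < ⌈2 log₂ n⌉ = Nat.clog 2 (n²)`) is not in `NP`.
Landed top equivalence (`Theorems/RamseyUncertifiableRamseyNotNPProofSystemForm.lean`, p137404):
`ramseyNotNP_iff_forall_not_isPolyBounded : X ↔ ∀ V, IsProofSystemFor V RAMSEY₂ → ¬ IsPolyBounded V`
— X says EVERY Cook–Reckhow certifier of Ramsey-ness has, infinitely often, only super-polynomial proofs.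

GRADATION (X's own language): restrict the certifier.  The canonical certifier family is
"a `V`-proof of `⟨n, G⟩ ∈ RAMSEY₂` is a PAIR of resolution refutations of the unary clique formulas
`cliqueCNF n k G`, `cliqueCNF n k Gᶜ`, `k = Nat.clog 2 (n²)`", graded by the refutation-DAG class `R`:
tree-like ⊂ regular ⊂ general DAG (`R = ⊤`) ⊂ … ⊂ all certifiers (= X).
`ResRung R` below is the io / ∃-graph / super-polynomial form — the form X actually implies (on-path).

* floor in tree: `resRung_treeLike : ResRung IsTreeLike` — PROVED below (no sorry) from the landed
  `treeLike_uncertainty` + `ramseyAbundant_proof`; also published standalone as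
  `Lines/ladder_dag_resolution_special.lean`.  (Pin-monotone / careful DAG refutations are further landed rungs.)
* floor in print: `ResRung IsRegular` (Atserias–Bonacina–de Rezende–Lauria–Nordström–Razborov, JACM 2021,
  arXiv:2012.09476 Thm 5.1 + §5: G(n,½) a.a.s., k = O(log n), via clause-monotonicity in k) — not formalised.
* NEXT RUNG = `stub_resRung : ResRung (fun _ => True)` — general (DAG-like) resolution; OPEN in print
  (ABdRLNR21 §9; Lauria–Pudlák–Rödl–Thapen 2017 §1.1 for the unary encoding; de Rezende–Potechin–Risse
  arXiv:2404.16722 p.3; arXiv:2605.10941 §1.1), strictly weaker than the route's every-graph item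
  `ResolutionUncertainty` (stmt-PneNP-9816, `n^{ε log n}` for ALL graphs).
* GAP = `stub_limit` — the passage from resolution pairs to ALL certifiers: a Ramsey certifier that is not
  polynomially dominated by resolution pairs is not polynomially bounded.  On-path (X → it, trivially), does not
  give X without the rung; summit-strength in difficulty (STRATEGY-CENSUS F1) — disposition frontier, stated honestly.
* `RamseyNotNP_of : stub_resRung → stub_limit → RamseyNotNP` — kernel-checked composition (no sorry).

Conventions: `sorry` appears ONLY in the two `stub_*` theorems.
-/

set_option linter.dupNamespace false

namespace Summit.PneNP.PneNP.Cruxes.RamseyNotNP.LadderDagResolution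

open Literature.Computability.Complexity Literature.Computability.MetaComplexity
open Summit.PneNP.PneNP.Theses.RamseyUncertifiable (RamseyNotNP RamseyAbundant)
open Summit.PneNP.PneNP.Theorems (ramseyAbundant_proof)
open Summit.PneNP.PneNP.Theorems.RegularResolutionRung.Negative (cliqueCNF)
open Summit.PneNP.PneNP.Theorems.RamseyNotNP.ProofSystemForm (ramseyNotNP_iff_forall_not_isPolyBounded)

/-! ### Vocabulary of the ladder -/

/-- RAMSEY₂ as a language: codes of `⟨n, G⟩` with `G` and `Gᶜ` both `Nat.clog 2 (n²)`-clique-free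
(verbatim the set of the crux `RamseyNotNP`). -/
abbrev Ram : Language Bool :=
  encodingGraph.toLanguage {p : Σ n, SimpleGraph (Fin n) |
    p.2.CliqueFree (Nat.clog 2 (p.1 ^ 2)) ∧ p.2ᶜ.CliqueFree (Nat.clog 2 (p.1 ^ 2))}

/-- **The rung schema `ResRung R`** (gradation parameter = a class `R` of resolution refutation DAGs):
for every exponent `c`, for infinitely many `n`, SOME `n`-vertex Ramsey graph `G` (both `G`, `Gᶜ`
`⌈2 log₂ n⌉`-clique-free) has NO pair of `R`-refutations of `cliqueCNF n ⌈2log₂ n⌉ G`, `cliqueCNF n ⌈2log₂ n⌉ Gᶜ`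
of total length `≤ n ^ c` — i.e. the `R`-resolution-pair certifier of Ramsey-ness is not polynomially bounded.
Antitone in `R`; `R = IsTreeLike` is landed, `R = IsRegular` is in print (a.a.s.), `R = ⊤` is the next rung. -/
def ResRung (R : List (ResLine ℕ) → Prop) : Prop :=
  ∀ c n₀ : ℕ, ∃ n, n₀ ≤ n ∧ ∃ G : SimpleGraph (Fin n),
    G.CliqueFree (Nat.clog 2 (n ^ 2)) ∧ Gᶜ.CliqueFree (Nat.clog 2 (n ^ 2)) ∧
    ∀ [DecidableRel G.Adj], ∀ π₁ π₂ : List (ResLine ℕ),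
      IsResRefutation (cliqueCNF n (Nat.clog 2 (n ^ 2)) fun u v => decide (G.Adj u v)) π₁ →
      IsResRefutation (cliqueCNF n (Nat.clog 2 (n ^ 2)) fun u v => decide (Gᶜ.Adj u v)) π₂ →
      R π₁ → R π₂ → n ^ c < max π₁.length π₂.length

/-- **`ResDominates V`**: the certifier `V` is polynomially dominated by resolution pairs — from any
`V`-proof `w` of the code of `⟨n, G⟩` one gets a pair of resolution refutations of the two clique formulas of
total length `≤ (|w| + n + 2) ^ c`. (E.g. `V` = the resolution-pair checker itself, or anything it p-simulates.) -/
def ResDominates (V : List Bool → List Bool → Bool) : Prop :=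
  ∃ c : ℕ, ∀ (n : ℕ) (G : SimpleGraph (Fin n)) [DecidableRel G.Adj] (w : List Bool),
    V (encodingGraph.encode ⟨n, G⟩) w = true →
    ∃ π₁ π₂ : List (ResLine ℕ),
      IsResRefutation (cliqueCNF n (Nat.clog 2 (n ^ 2)) fun u v => decide (G.Adj u v)) π₁ ∧
      IsResRefutation (cliqueCNF n (Nat.clog 2 (n ^ 2)) fun u v => decide (Gᶜ.Adj u v)) π₂ ∧
      max π₁.length π₂.length ≤ (w.length + n + 2) ^ c

/-! ### The two registered stubs (`sorry` lives ONLY here) -/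

/-- **Stub 1 — the NEXT RUNG (crux of the line; open problem in print, XL).** General DAG-like resolution:
the resolution-pair certifier of Ramsey-ness is not polynomially bounded — for every `c`, infinitely often some
Ramsey graph `G` on `n` vertices admits no pair of resolution refutations of `Clique(G,⌈2log₂n⌉)`,
`Clique(Gᶜ,⌈2log₂n⌉)` of length `≤ n^c`.  Why plausibly true: true for tree-like (landed), regular (ABdRLNR21
Thm 5.1, a.a.s.), unary Sherali–Adams with bounded coefficients (dRPR FOCS 2023); the brute-force upper bound is
`n^{O(log n)}`.  Why it might fail: all known resolution lower-bound techniques (size–width, Haken bottleneck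
counting, random restrictions) provably or empirically stall on unary `k`-clique for `k ≤ √n` (ABdRLNR21 §1, §9). -/
theorem stub_resRung : ResRung fun _ => True := by
  sorry

/-- **Stub 2 — the GAP / passage to the limit (on-path; summit-strength in difficulty, frontier).**
Every Cook–Reckhow proof system for RAMSEY₂ that is NOT polynomially dominated by resolution pairs is not
polynomially bounded.  (X gives it outright; together with Stub 1 it gives X; alone it does not — the missing
input is exactly Stub 1.)  Why it might fail: it fails iff RAMSEY₂ ∈ NP via a certifier essentially stronger than
resolution pairs — i.e. iff X is false for a non-resolution reason. -/
theorem stub_limit :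
    ∀ V : List Bool → List Bool → Bool, IsProofSystemFor V Ram → ¬ ResDominates V → ¬ IsPolyBounded V := by
  sorry

/-! ### Name-keyed statements of the stubs (the hypotheses of the composition, as in `Lines/Sketch.lean`) -/
namespace Registered

/-- Statement of Stub 1 (NEXT RUNG). -/
abbrev stub_resRung : Prop := ResRung fun _ => True

/-- Statement of Stub 2 (GAP). -/
abbrev stub_limit : Prop :=
  ∀ V : List Bool → List Bool → Bool, IsProofSystemFor V Ram → ¬ ResDominates V → ¬ IsPolyBounded V

end Registered

/-! ### Glue (proved) -/

/-- Length of the code of `⟨n, G⟩`: numeral field twice + separator + `n²` adjacency bits. [folklore] -/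
theorem length_code (n : ℕ) (G : SimpleGraph (Fin n)) :
    (encodingGraph.encode ⟨n, G⟩).length = 2 * (Computability.encodeNat n).length + 2 + n * n := by
  rw [HamNP.encode_eq, length_boolPair, CliqueNP.length_adjBits]

/-- `|code ⟨n, G⟩| ≤ (n + 2)²`. [folklore] -/
theorem length_code_le (n : ℕ) (G : SimpleGraph (Fin n)) :
    (encodingGraph.encode ⟨n, G⟩).length ≤ (n + 2) ^ 2 := by
  rw [length_code]
  have h : (Computability.encodeNat n).length ≤ n := by
    rw [TM2Pass.length_encodeNat_eq_size]
    exact Nat.size_le.2 n.lt_two_pow_self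
  nlinarith

/-- `n² + 2 ≤ |code ⟨n, G⟩|`. [folklore] -/
theorem nsq_le_length_code (n : ℕ) (G : SimpleGraph (Fin n)) :
    n * n + 2 ≤ (encodingGraph.encode ⟨n, G⟩).length :=
  HamNP.nsq_add_two_le_length_encode n G

/-- Elementary exponent bookkeeping: `(L + n + 2)^c ≤ n^{c(4k+2)}` when `L ≤ N^k`, `N ≤ (n+2)²`, `n ≥ 4`. -/
theorem pow_bound {n k c L N : ℕ} (hn : 4 ≤ n) (hk : 1 ≤ k) (hN : N ≤ (n + 2) ^ 2) (hL : L ≤ N ^ k) :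
    (L + n + 2) ^ c ≤ n ^ (c * (4 * k + 2)) := by
  have h1 : n + 2 ≤ n ^ 2 := by nlinarith
  have h2 : N ≤ n ^ 4 := hN.trans (by
    calc (n + 2) ^ 2 ≤ (n ^ 2) ^ 2 := Nat.pow_le_pow_left h1 2
      _ = n ^ 4 := by ring)
  have h3 : L ≤ n ^ (4 * k) := hL.trans (by
    calc N ^ k ≤ (n ^ 4) ^ k := Nat.pow_le_pow_left h2 k
      _ = n ^ (4 * k) := by rw [← pow_mul])
  have h4 : n + 2 ≤ n ^ (4 * k) :=
    h1.trans (Nat.pow_le_pow_right (by omega) (by omega))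
  have h5 : L + n + 2 ≤ n ^ (4 * k + 1) := by
    calc L + n + 2 ≤ n ^ (4 * k) + n ^ (4 * k) := by omega
      _ = 2 * n ^ (4 * k) := by ring
      _ ≤ n * n ^ (4 * k) := Nat.mul_le_mul_right _ (by omega)
      _ = n ^ (4 * k + 1) := by ring
  calc (L + n + 2) ^ c ≤ (n ^ (4 * k + 1)) ^ c := Nat.pow_le_pow_left h5 c
    _ = n ^ ((4 * k + 1) * c) := by rw [← pow_mul]
    _ ≤ n ^ (c * (4 * k + 2)) := Nat.pow_le_pow_right (by omega) (by nlinarith)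

/-- Monotonicity of the ladder: a larger DAG class gives a stronger rung. -/
theorem ResRung.anti {R R' : List (ResLine ℕ) → Prop} (hRR' : ∀ π, R π → R' π) (h : ResRung R') :
    ResRung R := by
  intro c n₀
  obtain ⟨n, hn, G, hG, hGc, hbad⟩ := h c n₀
  refine ⟨n, hn, G, hG, hGc, ?_⟩
  intro _ π₁ π₂ h₁ h₂ r₁ r₂
  exact hbad π₁ π₂ h₁ h₂ (hRR' _ r₁) (hRR' _ r₂)

/-! ### The floor (F3 witness, proved): the rung schema at `R = IsTreeLike` -/

open Summit.PneNP.PneNP.Theorems.RamseyUncertifiableResolutionUncertainty (treeLike_uncertainty) in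
/-- The floor at a given `n ≥ 2^{9c+22}`: some Ramsey graph on `n` vertices all of whose TREE-LIKE refutation
pairs exceed `n^c` — from the landed `treeLike_uncertainty` (every graph, `n^{(log₂ n)/9} ≤ max`) and
`ramseyAbundant_proof` (Erdős 1947). -/
theorem resRung_treeLike_at {c n : ℕ} (hpow : 2 ^ (9 * c + 22) ≤ n) :
    ∃ G : SimpleGraph (Fin n),
      G.CliqueFree (Nat.clog 2 (n ^ 2)) ∧ Gᶜ.CliqueFree (Nat.clog 2 (n ^ 2)) ∧
      ∀ [DecidableRel G.Adj], ∀ π₁ π₂ : List (ResLine ℕ),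
        IsResRefutation (cliqueCNF n (Nat.clog 2 (n ^ 2)) fun u v => decide (G.Adj u v)) π₁ →
        IsResRefutation (cliqueCNF n (Nat.clog 2 (n ^ 2)) fun u v => decide (Gᶜ.Adj u v)) π₂ →
        IsTreeLike π₁ → IsTreeLike π₂ → n ^ c < max π₁.length π₂.length := by
  have h22 : 2 ^ 22 ≤ n := le_trans (Nat.pow_le_pow_right (by norm_num) (by omega)) hpow
  have hn3 : 3 ≤ n := le_trans (by norm_num) h22
  obtain ⟨G, hG, hGc⟩ := ramseyAbundant_proof n hn3
  refine ⟨G, hG, hGc, ?_⟩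
  intro _ π₁ π₂ h₁ h₂ ht₁ ht₂
  have key := treeLike_uncertainty n h22 G (Nat.clog 2 (n ^ 2)) (Nat.clog 2 (n ^ 2)) π₁ π₂ h₁ ht₁ h₂ ht₂
  have hn1 : (1 : ℝ) < n := by exact_mod_cast lt_of_lt_of_le (by norm_num) hn3
  have hnpos : (0 : ℝ) < n := by linarith
  have hlog : ((9 * c + 22 : ℕ) : ℝ) ≤ Real.logb 2 n := by
    rw [Real.le_logb_iff_rpow_le (by norm_num) hnpos, Real.rpow_natCast]
    exact_mod_cast hpow
  have hc : (c : ℝ) < Real.logb 2 n / 9 := by push_cast at hlog; linarith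
  have hlt : (n : ℝ) ^ (c : ℝ) < (n : ℝ) ^ (Real.logb 2 n / 9) :=
    Real.rpow_lt_rpow_of_exponent_lt hn1 hc
  have e1 : ((n ^ c : ℕ) : ℝ) = (n : ℝ) ^ (c : ℝ) := by rw [Nat.cast_pow, Real.rpow_natCast]
  have e2 : ((max π₁.length π₂.length : ℕ) : ℝ) = max (π₁.length : ℝ) (π₂.length : ℝ) := Nat.cast_max _ _
  have : ((n ^ c : ℕ) : ℝ) < ((max π₁.length π₂.length : ℕ) : ℝ) := by
    rw [e1, e2]; exact hlt.trans_le key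
  exact_mod_cast this

/-- **FLOOR RUNG (proved, no sorry): `ResRung IsTreeLike`** — the rung schema specialises to the landed tree-like
uncertainty principle.  (`stub_resRung` is the same schema one DAG class up: `R = ⊤`.) -/
theorem resRung_treeLike : ResRung IsTreeLike := fun c n₀ =>
  ⟨max n₀ (2 ^ (9 * c + 22)), le_max_left _ _, resRung_treeLike_at (le_max_right _ _)⟩

/-! ### On-path record (F4): X gives the gap outright -/

open Summit.PneNP.PneNP.Theorems.RamseyNotNP.ProofSystemForm (not_isPolyBounded_of_ramseyNotNP) in
/-- `X → stub_limit` (the gap is a consequence of the crux: X kills EVERY certifier). The other converse,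
`X → stub_resRung`, holds on paper via the poly-time resolution-pair checker (a Cook–Reckhow system for RAMSEY₂
dominated by resolution pairs) but needs that checker formalised (`IsPolyTimeVerifier`); it is not claimed here. -/
theorem limit_of_ramseyNotNP (hX : RamseyNotNP) : Registered.stub_limit :=
  fun _ hV _ => not_isPolyBounded_of_ramseyNotNP hX hV

/-! ### Attack device (proved): clause-monotonicity in the threshold — print lower bounds at `k' ≥ ⌈2log₂n⌉` transfer DOWN -/

/-- Validity of a resolution line is monotone in the axiom set. -/
theorem isValidResLine_mono {φ φ' : CNF ℕ} (hsub : ∀ C ∈ φ.clauseFinsets, C ∈ φ'.clauseFinsets)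
    {prev : List (ResLine ℕ)} {l : ResLine ℕ} (h : IsValidResLine φ prev l) :
    IsValidResLine φ' prev l := by
  unfold IsValidResLine at h ⊢
  split
  · next heq => simp only [heq] at h; exact hsub _ h
  · next i j v heq => simp only [heq] at h; exact h
  · next i heq => simp only [heq] at h; exact h

/-- Derivations are monotone in the axiom set. -/
theorem isResDerivation_mono {φ φ' : CNF ℕ} (hsub : ∀ C ∈ φ.clauseFinsets, C ∈ φ'.clauseFinsets)
    {π : List (ResLine ℕ)} (h : IsResDerivation φ π) : IsResDerivation φ' π :=
  fun k hk => isValidResLine_mono hsub (h k hk)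

/-- Refutations are monotone in the axiom set (more axioms, same refutation). -/
theorem isResRefutation_mono {φ φ' : CNF ℕ} (hsub : ∀ C ∈ φ.clauseFinsets, C ∈ φ'.clauseFinsets)
    {π : List (ResLine ℕ)} (h : IsResRefutation φ π) : IsResRefutation φ' π :=
  ⟨isResDerivation_mono hsub h.1, h.2⟩

theorem clauseFinsets_mono {φ φ' : CNF ℕ} (h : ∀ c ∈ φ, c ∈ φ') :
    ∀ C ∈ φ.clauseFinsets, C ∈ φ'.clauseFinsets := by
  intro C hC
  simp only [CNF.clauseFinsets, List.mem_map] at hC ⊢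
  obtain ⟨c, hc, rfl⟩ := hC
  exact ⟨c, h c hc, rfl⟩

/-- CLAUSE-MONOTONICITY IN THE THRESHOLD: `Clique(G,k) ⊆ Clique(G,k')` for `k ≤ k'` (blocks `0..k-1` are shared). -/
theorem cliqueCNF_subset {n k k' : ℕ} (hk : k ≤ k') (adj : Fin n → Fin n → Bool) :
    ∀ C ∈ cliqueCNF n k adj, C ∈ cliqueCNF n k' adj := by
  intro C hC
  simp only [cliqueCNF, List.mem_append] at hC ⊢
  rcases hC with (h1 | h2) | h3
  · left; left
    simp only [List.mem_map, List.mem_range] at h1 ⊢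
    obtain ⟨i, hi, rfl⟩ := h1
    exact ⟨i, lt_of_lt_of_le hi hk, rfl⟩
  · left; right
    simp only [List.mem_flatMap, List.mem_range] at h2 ⊢
    obtain ⟨i, hi, rest⟩ := h2
    exact ⟨i, lt_of_lt_of_le hi hk, rest⟩
  · right
    simp only [List.mem_flatMap, List.mem_range] at h3 ⊢
    obtain ⟨i, hi, j, hj, rest⟩ := h3
    exact ⟨i, lt_of_lt_of_le hi hk, j, lt_of_lt_of_le hj hk, rest⟩

/-- Hence a refutation of `Clique(G,k)` is a refutation of `Clique(G,k')` for every `k' ≥ k`: minimal refutation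
length is ANTITONE in the threshold, so lower bounds proved at a larger threshold `k'` (e.g. `4 log₂ n`, where the
clique-denseness of `G(n,½)` holds) transfer DOWN to the Ramsey threshold `Nat.clog 2 (n²)`. -/
theorem isResRefutation_cliqueCNF_mono {n k k' : ℕ} (hk : k ≤ k') (adj : Fin n → Fin n → Bool)
    {π : List (ResLine ℕ)} (h : IsResRefutation (cliqueCNF n k adj) π) :
    IsResRefutation (cliqueCNF n k' adj) π :=
  isResRefutation_mono (clauseFinsets_mono (cliqueCNF_subset hk adj)) h

/-- THRESHOLD TRANSFER: hardness of `R`-refutation pairs of the clique formulas at ANY larger threshold `k' n ≥ Nat.clog 2 (n²)`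
on Ramsey graphs already gives the rung (this is how the in-print regular floor, ABdRLNR21 Thm 5.1 at `k' = ⌈4 log₂ n⌉` where
G(n,½) is clique-dense with ξ ≈ 2, lands on the Ramsey threshold). -/
theorem ResRung.of_threshold_ge {R : List (ResLine ℕ) → Prop} (k' : ℕ → ℕ) (hk : ∀ n, Nat.clog 2 (n ^ 2) ≤ k' n)
    (H : ∀ c n₀ : ℕ, ∃ n, n₀ ≤ n ∧ ∃ G : SimpleGraph (Fin n),
      G.CliqueFree (Nat.clog 2 (n ^ 2)) ∧ Gᶜ.CliqueFree (Nat.clog 2 (n ^ 2)) ∧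
      ∀ [DecidableRel G.Adj], ∀ π₁ π₂ : List (ResLine ℕ),
        IsResRefutation (cliqueCNF n (k' n) fun u v => decide (G.Adj u v)) π₁ →
        IsResRefutation (cliqueCNF n (k' n) fun u v => decide (Gᶜ.Adj u v)) π₂ →
        R π₁ → R π₂ → n ^ c < max π₁.length π₂.length) : ResRung R := by
  intro c n₀
  obtain ⟨n, hn, G, hG, hGc, hH⟩ := H c n₀
  refine ⟨n, hn, G, hG, hGc, ?_⟩
  intro _ π₁ π₂ h₁ h₂ r₁ r₂
  exact hH π₁ π₂ (isResRefutation_cliqueCNF_mono (hk n) _ h₁) (isResRefutation_cliqueCNF_mono (hk n) _ h₂) r₁ r₂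

/-! ### The composition: the two stubs prove the crux BY NAME -/

/-- **`RamseyNotNP_of`**: NEXT RUNG + GAP ⟹ X.  Given a Cook–Reckhow certifier `V` of Ramsey-ness: if `V` is
polynomially dominated by resolution pairs, a polynomial bound on `V`-proofs would give polynomial-length resolution
pairs for every Ramsey graph, contradicting the rung; otherwise the gap applies. Then `X` by the landed
`ramseyNotNP_iff_forall_not_isPolyBounded`. -/
theorem RamseyNotNP_of (hR : Registered.stub_resRung) (hL : Registered.stub_limit) : RamseyNotNP := by
  refine ramseyNotNP_iff_forall_not_isPolyBounded.mpr fun V hV => ?_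
  by_cases hdom : ResDominates V
  · rintro ⟨p, hp⟩
    obtain ⟨c, hc⟩ := hdom
    obtain ⟨k, hk1, hk⟩ := exists_pow_dominates p
    obtain ⟨n, hn4, G, hG, hGc, hbad⟩ := hR (c * (4 * k + 2)) 4
    classical
    have hx : encodingGraph.encode ⟨n, G⟩ ∈ Ram :=
      (Computability.Encoding.mem_toLanguage_iff _ _ _).2 ⟨hG, hGc⟩
    obtain ⟨w, hw⟩ := (hV.2 _).1 hx
    obtain ⟨w', hw'len, hw'⟩ := hp _ _ hw
    obtain ⟨π₁, π₂, h₁, h₂, hmax⟩ := hc n G w' hw'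
    have hlt := hbad π₁ π₂ h₁ h₂ trivial trivial
    have hN2 : 2 ≤ (encodingGraph.encode ⟨n, G⟩).length :=
      le_trans (by omega) (nsq_le_length_code n G)
    have hL : w'.length ≤ (encodingGraph.encode ⟨n, G⟩).length ^ k :=
      hw'len.trans (hk _ hN2)
    have harith := pow_bound (c := c) hn4 hk1 (length_code_le n G) hL
    exact absurd (hlt.trans_le (hmax.trans harith)) (lt_irrefl _)
  · exact hL V hV hdom

/-- The composition instantiated with the registered stubs (closed modulo exactly the two `sorry`s). -/
theorem RamseyNotNP_closed : RamseyNotNP := RamseyNotNP_of stub_resRung stub_limit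

end Summit.PneNP.PneNP.Cruxes.RamseyNotNP.LadderDagResolution
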